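import Summits.AtomisticToContinuum.Crystallization.Theorems.ExcessDecayLiouvilleCutoff
import Summits.AtomisticToContinuum.Crystallization.Theorems.ExcessDecayLiouvilleTranslation
import Summits.AtomisticToContinuum.Crystallization.Theorems.ExcessDecayLiouvilleDiscreteTaylor

/-!
# Route `ExcessDecayLiouville`: the graph Poincaré inequality on a ball

Step (e′) (`DirichletResponse`, first half) of the energy route for item `ExcessDecay`
(stmt-AtomisticToContinuum-9334): for a displacement `w` supported in the closed ball `B_R(c)` (finitely supported),

`Σ'_{p ∈ S} ‖w p‖² ≤ (400R/189 + 2)² · nnForm t A w`   (`tsum_norm_sq_le_mul_nnForm`),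

i.e. the `ℓ²` mass is controlled by `R²` times the nearest-neighbour strain form.  Proof: along the in-plane ray
`p, p + Au₁, p + 2Au₁, …` the displacement vanishes after `N = ⌈400R/189⌉ + 1` steps (`‖A u₁‖ ≥ 189/200`), so `w p`
telescopes into `N` nearest-neighbour differences; Cauchy–Schwarz, the translation invariance of the site set
(`exists_sitesShift`) and `tsum_norm_sub_translate_sq_le_nnForm` give the claim.  Together with the coercivity
`κ·nnForm ≤ ⟪Lw,w⟫` (`coercive_of_phononStability`) this yields `‖w‖₂ ≤ C R² ‖Lw‖₂` for the Dirichlet correction.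
All `[folklore]`; helper lemmas, nothing here closes an item.
-/

noncomputable section

namespace Summit.AtomisticToContinuum.Crystallization.Theorems.ExcessDecayLiouville

open scoped BigOperators Topology InnerProductSpace RealInnerProductSpace Classical
open Literature.MathematicalPhysics.StatisticalMechanics
open Summit.AtomisticToContinuum.Crystallization.Theorems.PhononStabilityNegative

section

variable {t : Fin 2 → (EuclideanSpace ℝ (Fin 3))} {A : (EuclideanSpace ℝ (Fin 3)) →L[ℝ] (EuclideanSpace ℝ (Fin 3))}

/-- A point of the ball pushed `N` steps along `A u₁` leaves the ball once `N · 189/200 > 2R`. [folklore] -/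
theorem not_mem_closedBall_add_smul (hA : Adm₀ A) {c p : (EuclideanSpace ℝ (Fin 3))} {R : ℝ} (hp : p ∈ Metric.closedBall c R)
    {N : ℕ} (hN : 2 * R < (N : ℝ) * (189 / 200)) :
    p + (N : ℝ) • A (triangularVec₁ 1) ∉ Metric.closedBall c R := by
  intro hmem
  rw [Metric.mem_closedBall] at hp hmem
  have hu : (189 / 200 : ℝ) ≤ ‖A (triangularVec₁ 1)‖ := by
    have := hcpLiouvilleAdm_norm_le hA (triangularVec₁ 1)
    rw [norm_triangularVec₁, mul_one] at this
    exact this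
  have hnorm : ‖(N : ℝ) • A (triangularVec₁ 1)‖ = (N : ℝ) * ‖A (triangularVec₁ 1)‖ := by
    rw [norm_smul, Real.norm_eq_abs, abs_of_nonneg (by positivity)]
  have htri : ‖(N : ℝ) • A (triangularVec₁ 1)‖ ≤ dist (p + (N : ℝ) • A (triangularVec₁ 1)) c + dist p c := by
    have := dist_triangle (p + (N : ℝ) • A (triangularVec₁ 1)) c p
    rw [dist_eq_norm (p + (N : ℝ) • A (triangularVec₁ 1)) p, add_sub_cancel_left, dist_comm c p] at this
    exact this
  have hN0 : (0 : ℝ) ≤ N := by positivity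
  nlinarith [hu, hnorm, htri, hmem, hp, hN0]

/-- Pointwise telescoping bound: if `w` vanishes at `p + N·Au₁`, then
`‖w p‖² ≤ N · Σ_{s<N} ‖w (p + (s+1)·Au₁) − w (p + s·Au₁)‖²`. [folklore] -/
theorem norm_sq_le_mul_sum_diff (w : (EuclideanSpace ℝ (Fin 3)) → (EuclideanSpace ℝ (Fin 3))) (p : (EuclideanSpace ℝ (Fin 3))) {N : ℕ}
    (hN : w (p + (N : ℝ) • A (triangularVec₁ 1)) = 0) :
    ‖w p‖ ^ 2 ≤ (N : ℝ) * ∑ s ∈ Finset.range N,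
      ‖w (p + ((s + 1 : ℕ) : ℝ) • A (triangularVec₁ 1)) - w (p + (s : ℝ) • A (triangularVec₁ 1))‖ ^ 2 := by
  set g : ℕ → (EuclideanSpace ℝ (Fin 3)) := fun s => w (p + (s : ℝ) • A (triangularVec₁ 1)) with hg
  have h0 : g 0 = w p := by simp [hg]
  have hNg : g N = 0 := hN
  have htel := sub_eq_sum_diff g N
  rw [hNg, h0, zero_sub] at htel
  have hnorm : ‖w p‖ ≤ ∑ s ∈ Finset.range N, ‖g (s + 1) - g s‖ := by
    rw [← norm_neg, htel]
    exact norm_sum_le _ _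
  have hcs : (∑ s ∈ Finset.range N, ‖g (s + 1) - g s‖) ^ 2 ≤ N * ∑ s ∈ Finset.range N, ‖g (s + 1) - g s‖ ^ 2 := by
    have := sq_sum_le_card_mul_sum_sq (s := Finset.range N) (f := fun s => ‖g (s + 1) - g s‖)
    simpa [Finset.card_range] using this
  have h1 : ‖w p‖ ^ 2 ≤ (∑ s ∈ Finset.range N, ‖g (s + 1) - g s‖) ^ 2 := pow_le_pow_left₀ (norm_nonneg _) hnorm 2
  exact h1.trans hcs

/-- **Graph Poincaré inequality on a ball** (see the module docstring). [folklore] -/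
theorem tsum_norm_sq_le_mul_nnForm (hA : Adm₀ A) (hI : Inner₀ t A) {w : (EuclideanSpace ℝ (Fin 3)) → (EuclideanSpace ℝ (Fin 3))}
    (hw : (Function.support w).Finite) {c : (EuclideanSpace ℝ (Fin 3))} {R : ℝ} (hR : 0 ≤ R)
    (hwR : Function.support w ⊆ Metric.closedBall c R) :
    ∑' p : Sites₀ t A, ‖w p‖ ^ 2 ≤ (400 * R / 189 + 2) ^ 2 * nnForm t A w := by
  classical
  -- number of steps
  set N : ℕ := ⌈400 * R / 189⌉₊ + 1 with hNdef
  have hN1 : 2 * R < (N : ℝ) * (189 / 200) := by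
    have hc := Nat.le_ceil (400 * R / 189)
    have : (N : ℝ) = (⌈400 * R / 189⌉₊ : ℝ) + 1 := by simp [hNdef]
    rw [this]
    nlinarith
  have hN2 : (N : ℝ) ≤ 400 * R / 189 + 2 := by
    have hc := (Nat.ceil_lt_add_one (by positivity : (0 : ℝ) ≤ 400 * R / 189)).le
    have : (N : ℝ) = (⌈400 * R / 189⌉₊ : ℝ) + 1 := by simp [hNdef]
    rw [this]
    linarith
  -- pointwise bound at every site
  have hpt : ∀ p : Sites₀ t A, ‖w p‖ ^ 2 ≤ (N : ℝ) * ∑ s ∈ Finset.range N,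
      ‖w ((p : (EuclideanSpace ℝ (Fin 3))) + ((s + 1 : ℕ) : ℝ) • A (triangularVec₁ 1)) - w ((p : (EuclideanSpace ℝ (Fin 3))) + (s : ℝ) • A (triangularVec₁ 1))‖ ^ 2 := by
    intro p
    by_cases hp : (p : (EuclideanSpace ℝ (Fin 3))) ∈ Function.support w
    · refine norm_sq_le_mul_sum_diff w (p : (EuclideanSpace ℝ (Fin 3))) ?_
      by_contra hne
      exact not_mem_closedBall_add_smul hA (hwR hp) hN1 (hwR hne)
    · rw [Function.mem_support, not_not] at hp
      rw [hp, norm_zero]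
      have : (0 : ℝ) ^ 2 = 0 := by norm_num
      rw [this]
      positivity
  -- each shifted difference family is summable and its tsum is ≤ nnForm
  have hu : triangularVec₁ 1 ∈ Λ₀ := triangularVec₁_mem_Λ₀
  have hAu : ‖A (triangularVec₁ 1)‖ ≤ 11 / 10 := by
    have := norm_apply_le_of_adm₀ hA (triangularVec₁ 1)
    rw [norm_triangularVec₁, mul_one] at this
    linarith
  have hsmul_mem : ∀ s : ℕ, (s : ℝ) • (triangularVec₁ 1 : (EuclideanSpace ℝ (Fin 3))) ∈ Λ₀ := by
    intro s
    have : ((s : ℝ) • (triangularVec₁ 1 : (EuclideanSpace ℝ (Fin 3)))) = ((s : ℤ) : ℝ) • triangularVec₁ 1 + ((0 : ℤ) : ℝ) • triangularVec₂ 1 +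
        ((0 : ℤ) : ℝ) • layerNormal (2 * Real.sqrt (2 / 3)) := by simp
    rw [this]
    exact ⟨s, 0, 0, rfl⟩
  have hdiff : ∀ s : ℕ, ∑' p : Sites₀ t A,
      ‖w ((p : (EuclideanSpace ℝ (Fin 3))) + ((s + 1 : ℕ) : ℝ) • A (triangularVec₁ 1)) - w ((p : (EuclideanSpace ℝ (Fin 3))) + (s : ℝ) • A (triangularVec₁ 1))‖ ^ 2 ≤
        nnForm t A w := by
    intro s
    obtain ⟨e, he⟩ := exists_sitesShift (t := t) (A := A) (hsmul_mem s)
    have hmain := tsum_norm_sub_translate_sq_le_nnForm hA hI hw hu hAu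
    -- reindex along the shift by s·u₁
    have hre : ∑' p : Sites₀ t A,
        ‖w ((p : (EuclideanSpace ℝ (Fin 3))) + ((s + 1 : ℕ) : ℝ) • A (triangularVec₁ 1)) - w ((p : (EuclideanSpace ℝ (Fin 3))) + (s : ℝ) • A (triangularVec₁ 1))‖ ^ 2 =
        ∑' p : Sites₀ t A, ‖w ((e p : Sites₀ t A) : (EuclideanSpace ℝ (Fin 3))) - w (((e p : Sites₀ t A) : (EuclideanSpace ℝ (Fin 3))) + A (triangularVec₁ 1))‖ ^ 2 := by
      refine tsum_congr fun p => ?_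
      rw [he p, map_smul, norm_sub_rev]
      congr 2
      · push_cast; rw [add_smul, one_smul, add_assoc]
    rw [hre, e.tsum_eq (fun q : Sites₀ t A => ‖w q - w ((q : (EuclideanSpace ℝ (Fin 3))) + A (triangularVec₁ 1))‖ ^ 2)]
    exact hmain
  have hsumm : ∀ s : ℕ, Summable (fun p : Sites₀ t A =>
      ‖w ((p : (EuclideanSpace ℝ (Fin 3))) + ((s + 1 : ℕ) : ℝ) • A (triangularVec₁ 1)) - w ((p : (EuclideanSpace ℝ (Fin 3))) + (s : ℝ) • A (triangularVec₁ 1))‖ ^ 2) := by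
    intro s
    obtain ⟨e, he⟩ := exists_sitesShift (t := t) (A := A) (hsmul_mem s)
    have hS := summable_norm_sub_map_sq (t := t) (A := A) hw (sitesTranslate_injective (t := t) (A := A) hu)
    have hS' : Summable (fun q : Sites₀ t A => ‖w q - w ((q : (EuclideanSpace ℝ (Fin 3))) + A (triangularVec₁ 1))‖ ^ 2) := hS
    refine (e.summable_iff.2 hS').congr fun p => ?_
    simp only [Function.comp_apply]
    rw [he p, map_smul, norm_sub_rev]
    congr 2
    · push_cast; rw [add_smul, one_smul, add_assoc]
  -- sum the pointwise bound
  have hL : Summable (fun p : Sites₀ t A => ‖w p‖ ^ 2) := by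
    refine summable_of_ne_finset_zero (s := (finite_support_sites (t := t) (A := A) hw).toFinset) ?_
    intro p hp
    have : w p = 0 := by
      by_contra h'
      exact hp ((Set.Finite.mem_toFinset _).2 h')
    simp [this]
  have hRsum : Summable (fun p : Sites₀ t A => (N : ℝ) * ∑ s ∈ Finset.range N,
      ‖w ((p : (EuclideanSpace ℝ (Fin 3))) + ((s + 1 : ℕ) : ℝ) • A (triangularVec₁ 1)) - w ((p : (EuclideanSpace ℝ (Fin 3))) + (s : ℝ) • A (triangularVec₁ 1))‖ ^ 2) :=
    (summable_sum fun s _ => hsumm s).mul_left _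
  calc ∑' p : Sites₀ t A, ‖w p‖ ^ 2
      ≤ ∑' p : Sites₀ t A, (N : ℝ) * ∑ s ∈ Finset.range N,
          ‖w ((p : (EuclideanSpace ℝ (Fin 3))) + ((s + 1 : ℕ) : ℝ) • A (triangularVec₁ 1)) - w ((p : (EuclideanSpace ℝ (Fin 3))) + (s : ℝ) • A (triangularVec₁ 1))‖ ^ 2 :=
        hL.tsum_le_tsum hpt hRsum
    _ = (N : ℝ) * ∑ s ∈ Finset.range N, ∑' p : Sites₀ t A,
          ‖w ((p : (EuclideanSpace ℝ (Fin 3))) + ((s + 1 : ℕ) : ℝ) • A (triangularVec₁ 1)) - w ((p : (EuclideanSpace ℝ (Fin 3))) + (s : ℝ) • A (triangularVec₁ 1))‖ ^ 2 := by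
        rw [tsum_mul_left, Summable.tsum_finsetSum (fun s _ => hsumm s)]
    _ ≤ (N : ℝ) * ∑ _s ∈ Finset.range N, nnForm t A w := by
        refine mul_le_mul_of_nonneg_left (Finset.sum_le_sum fun s _ => hdiff s) (by positivity)
    _ = (N : ℝ) * (N : ℝ) * nnForm t A w := by
        rw [Finset.sum_const, Finset.card_range, nsmul_eq_mul]; ring
    _ ≤ (400 * R / 189 + 2) ^ 2 * nnForm t A w := by
        have hnn : 0 ≤ nnForm t A w := by
          unfold nnForm
          exact tsum_nonneg fun p => tsum_nonneg fun q => by split_ifs <;> positivity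
        have hN0 : (0 : ℝ) ≤ N := by positivity
        have : (N : ℝ) * (N : ℝ) ≤ (400 * R / 189 + 2) ^ 2 := by nlinarith
        exact mul_le_mul_of_nonneg_right this hnn

end

end Summit.AtomisticToContinuum.Crystallization.Theorems.ExcessDecayLiouville

end
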